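import Literature.Computability.Complexity.ListFoldBricks
import Literature.NumberTheory.Primality.PrattCertificates
import HarnessLib

/-!
# A polynomial-time verifier for Pratt certificates

Family `PQC` / trunk `CplxCore`. The string form of the flat Pratt certificates of
`Literature/NumberTheory/Primality/PrattCertificates.lean` (`Pratt.Line = ℕ × ℕ × List ℕ`,
`Pratt.LineValid`, `Pratt.CertValid`, `Pratt.lines p`) and their verifier in the tree's algebra of
`FP` string functions (`BrickAlgebra.lean`, `ListFoldBricks.lean`: projections, one-bit conditions,
`allFn`/`anyFn`/`memHeadFn`/`prodListFn`/`eqValFn`; arithmetic leaves `modExpFn`, `divFn`, `subFn`,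
`ltFn`, `valGeTwoFn` of `StackBricks*.lean`), all in the sub-namespace `PrattMachine`:

* reading: a string `it` denotes the line `lineOf it = (⟦fstF it⟧, ⟦fstF (sndF it)⟧, values of
  the items of sndF (sndF it))`, a string `Ls` the certificate `linesOf Ls = (decNil Ls).map lineOf`
  (total: every string denotes some certificate); writing: `encLine`, `encLines`, with
  `lineOf_encLine`, `linesOf_encLines` and the length bound `length_encLines_lines_le`;
* truth lemmas for composing one-bit conditions propositionally (`andFn_eq_true_iff`, …);
* the bricks `powIsOneFn` (`g^e mod m = 1`), `qTestFn` (one prime factor of `p − 1`: certified and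
  `g^{(p−1)/q} ≢ 1`), `lineTestFn` (one line), `certTestFn` (all lines), each in `FP`, one-bit, with
  **`lineTestFn ⟨Ls, it⟩ = [1] ↔ Pratt.LineValid (heads (linesOf Ls)) (lineOf it)`** and
  **`certTestFn Ls = [1] ↔ Pratt.CertValid (linesOf Ls)`**.

`FACT ∈ coNP` (and `PRIMES ∈ NP`) are assembled from these in `FactoringProofs.lean`.

## References

* V. Pratt, *Every prime has a succinct certificate*, SIAM J. Comput. 4 (1975) 214–220.
* S. Arora, B. Barak, *Computational Complexity: A Modern Approach*, CUP 2009, §2.1 (Def. 2.1,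
  Example 2.3, Exercise 2.5), §1.3 (closure properties of polynomial time).
-/

namespace Literature.Computability.QuantumComplexity

namespace PrattMachine

open _root_.Computability Complexity Complexity.Classes Complexity.Brick
open Literature.NumberTheory.Primality

/-! ### Truth lemmas for one-bit conditions -/

section Truth

variable {c d : List Bool → List Bool} {z : List Bool}

/-- A one-bit condition that is not `[1]` is `[0]` (dot-notation extension of
`Literature.Computability.Complexity.Brick.OneBit` of `BrickAlgebra.lean`). [folklore] -/
theorem _root_.Literature.Computability.Complexity.Brick.OneBit.eq_false_of_ne_true (hc : OneBit c) (h : c z ≠ [true]) :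
    c z = [false] := by
  obtain ⟨b, hb⟩ := hc z
  cases b
  · exact hb
  · exact absurd hb h

/-- Truth of a conjunction. [folklore] -/
theorem andFn_eq_true_iff (hc : OneBit c) (hd : OneBit d) :
    andFn c d z = [true] ↔ c z = [true] ∧ d z = [true] := by
  obtain ⟨b, hb⟩ := hc z
  obtain ⟨b', hb'⟩ := hd z
  rw [andFn_apply hb hb', hb, hb']
  cases b <;> cases b' <;> simp

/-- Truth of a negation. [folklore] -/
theorem notFn_eq_true_iff (hc : OneBit c) : notFn c z = [true] ↔ ¬ c z = [true] := by
  obtain ⟨b, hb⟩ := hc z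
  rw [notFn_apply hb, hb]
  cases b <;> simp

/-- Truth of a disjunction. [folklore] -/
theorem orFn_eq_true_iff (hc : OneBit c) (hd : OneBit d) :
    orFn c d z = [true] ↔ c z = [true] ∨ d z = [true] := by
  obtain ⟨b, hb⟩ := hc z
  obtain ⟨b', hb'⟩ := hd z
  rw [orFn_apply hb hb', hb, hb']
  cases b <;> cases b' <;> simp

/-- Truth of a universal test over a coded list. [folklore] -/
theorem allFn_eq_true_iff (hc : OneBit c) (x L : List Bool) :
    allFn c (boolPair x L) = [true] ↔ ∀ a ∈ decNil L, c (boolPair x a) = [true] := by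
  rw [allFn_boolPair hc]; simp

/-- Truth of a membership test among heads. [folklore] -/
theorem memHeadFn_eq_true_iff (q L : List Bool) :
    memHeadFn (boolPair q L) = [true] ↔ ∃ item ∈ decNil L, bitsToNat (fstF item) = bitsToNat q := by
  rw [memHeadFn_boolPair]; simp

/-- Truth of an equality of values. [folklore] -/
theorem eqValFn_eq_true_iff (a b : List Bool) : eqValFn (boolPair a b) = [true] ↔ bitsToNat a = bitsToNat b := by
  rw [eqValFn_boolPair]; simp

/-- Truth of a comparison. [folklore] -/
theorem ltFn_eq_true_iff (a b : List Bool) : ltFn (boolPair a b) = [true] ↔ bitsToNat a < bitsToNat b := by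
  rw [ltFn_boolPair]; simp

/-- Truth of `valGeTwoFn`. [folklore] -/
theorem valGeTwoFn_eq_true_iff (a : List Bool) : valGeTwoFn a = [true] ↔ 2 ≤ bitsToNat a := by
  simp [valGeTwoFn]

end Truth

/-! ### Reading and writing lines -/

/-- The Pratt line denoted by a string `it = ⟨p, ⟨g, qs⟩⟩` (total; the string coding of lines is this
file's choice). [folklore] -/
def lineOf (it : List Bool) : Pratt.Line :=
  (bitsToNat (fstF it), bitsToNat (fstF (sndF it)), (decNil (sndF (sndF it))).map bitsToNat)

/-- The certificate denoted by a string (total). [folklore] -/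
def linesOf (Ls : List Bool) : List Pratt.Line := (decNil Ls).map lineOf

/-- The heads available in a coded certificate are the values of the first fields of its items.
[folklore] -/
theorem mem_heads_linesOf_iff (Ls : List Bool) (v : ℕ) :
    v ∈ Pratt.heads (linesOf Ls) ↔ ∃ item ∈ decNil Ls, bitsToNat (fstF item) = v := by
  simp only [Pratt.heads, linesOf, Set.mem_setOf_eq, List.mem_map]
  constructor
  · rintro ⟨l, ⟨it, hit, rfl⟩, hl⟩
    exact ⟨it, hit, hl⟩
  · rintro ⟨it, hit, hv⟩
    exact ⟨lineOf it, ⟨it, hit, rfl⟩, hv⟩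

/-- The code of a line: `⟨p, ⟨g, [q₁, …, qₗ]⟩⟩` in canonical binary. [folklore] -/
def encLine (l : Pratt.Line) : List Bool :=
  boolPair (encodeNat l.1) (boolPair (encodeNat l.2.1) (encList (l.2.2.map encodeNat)))

/-- The code of a certificate: the coded list of the codes of its lines. [folklore] -/
def encLines (ls : List Pratt.Line) : List Bool := encList (ls.map encLine)

/-- Reading back a written line. [folklore] -/
@[simp] theorem lineOf_encLine (l : Pratt.Line) : lineOf (encLine l) = l := by
  obtain ⟨p, g, qs⟩ := l
  simp [lineOf, encLine, fstF, sndF, List.map_map, Function.comp_def]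

/-- Reading back a written certificate. [folklore] -/
@[simp] theorem linesOf_encLines (ls : List Pratt.Line) : linesOf (encLines ls) = ls := by
  simp [linesOf, encLines, List.map_map, Function.comp_def]

/-- Length of a coded list of numerals: `Σ (2 |encodeNat q| + 2)`. [folklore] -/
theorem length_encList_map_encodeNat (qs : List ℕ) :
    (encList (qs.map encodeNat)).length = (qs.map fun q => 2 * q.size + 2).sum := by
  rw [length_encList, List.map_map]
  congr 1
  exact List.map_congr_left fun q _ => by simp [Function.comp_apply, TM2Pass.length_encodeNat_eq_size]

/-- **Length of the code of a line of a Lucas tree**: `|encLine (Pratt.line r)| ≤ 12 size r + 4`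
(head and witness `≤ size r` digits each, the factorisation of `r − 1` fewer than `2 size r` digits
and fewer than `size r` items). [folklore] -/
theorem length_encLine_line_le {r : ℕ} (hr : 0 < r) : (encLine (Pratt.line r)).length ≤ 12 * r.size + 4 := by
  have hw : (encodeNat (Pratt.lucasWitness r)).length ≤ r.size := by
    rw [TM2Pass.length_encodeNat_eq_size]
    exact Nat.size_le_size (Pratt.lucasWitness_lt (by omega)).le
  have hp : (encodeNat r).length = r.size := TM2Pass.length_encodeNat_eq_size r
  rcases Nat.eq_zero_or_pos (r - 1) with h0 | h1
  · -- r = 1: empty factorisation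
    have : (r - 1).primeFactorsList = [] := by rw [h0]; exact Nat.primeFactorsList_zero
    simp only [encLine, Pratt.line, this, List.map_nil, encList_nil, length_boolPair, List.length_nil, hp]
    omega
  · have hsz := Pratt.sum_size_primeFactorsList_lt (n := r - 1) (by omega)
    have hlen := Pratt.length_primeFactorsList_lt_size (n := r - 1) (by omega)
    have hmono : (r - 1).size ≤ r.size := Nat.size_le_size (Nat.sub_le r 1)
    have hsum : ((r - 1).primeFactorsList.map fun q => 2 * q.size + 2).sum =
        2 * ((r - 1).primeFactorsList.map Nat.size).sum + 2 * (r - 1).primeFactorsList.length := by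
      induction (r - 1).primeFactorsList with
      | nil => simp
      | cons q l ih => simp only [List.map_cons, List.sum_cons, List.length_cons, ih]; ring
    simp only [encLine, Pratt.line, length_boolPair, length_encList_map_encodeNat, hsum, hp]
    omega

/-- **Length of the code of the certificate of a prime**: `|encLines (Pratt.lines p)| ≤ 2 size p (24 size p + 10)`
(fewer than `2 size p` lines of at most `12 size p + 4` bits each, plus pairing overhead).
[cite: CrandallPomerance1999, Thm 4.1.9] -/
theorem length_encLines_lines_le {p : ℕ} (hp : p.Prime) :
    (encLines (Pratt.lines p)).length ≤ 2 * p.size * (24 * p.size + 10) := by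
  have hcount := Pratt.length_lines_lt hp
  have hline : ∀ l ∈ Pratt.lines p, 2 * (encLine l).length + 2 ≤ 24 * p.size + 10 := by
    intro l hl
    obtain ⟨r, hr, hrp, rfl⟩ := Pratt.mem_lines_iff hp.pos hl
    have h1 := length_encLine_line_le hr
    have h2 : r.size ≤ p.size := Nat.size_le_size hrp
    omega
  rw [encLines, length_encList, List.map_map]
  have key : ∀ ls : List Pratt.Line, (∀ l ∈ ls, 2 * (encLine l).length + 2 ≤ 24 * p.size + 10) →
      (ls.map ((fun a : List Bool => 2 * a.length + 2) ∘ encLine)).sum ≤ ls.length * (24 * p.size + 10) := by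
    intro ls
    induction ls with
    | nil => intro; simp
    | cons l ls ih =>
      intro h
      have h1 := h l List.mem_cons_self
      have h2 := ih fun l' hl' => h l' (List.mem_cons_of_mem _ hl')
      simp only [List.map_cons, List.sum_cons, Function.comp_apply, List.length_cons]
      nlinarith
  exact (key _ hline).trans (Nat.mul_le_mul_right _ (by omega))

/-! ### The bricks -/

/-- **`powIsOneFn ⟨g, ⟨e, m⟩⟩ = [⟦g⟧^⟦e⟧ mod ⟦m⟧ = 1]`** for a modulus `⟦m⟧ ≥ 2` (and `[0]` for
`⟦m⟧ ≤ 1`, where `modExpFn` returns `0`). [folklore] -/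
noncomputable def powIsOneFn : List Bool → List Bool := eqValFn ∘ fanoutFn modExpFn (fun _ => [true])

/-- `powIsOneFn ∈ FP`. [folklore] -/
theorem powIsOneFn_mem_FP : powIsOneFn ∈ FP :=
  comp_mem_FP eqValFn_mem_FP (fanoutFn_mem_FP modExpFn_mem_FP (const_mem_FP _))

/-- `powIsOneFn` is one-bit. [folklore] -/
theorem oneBit_powIsOneFn : OneBit powIsOneFn := oneBit_eqValFn.comp _

/-- **Truth of `powIsOneFn`.** [folklore] -/
theorem powIsOneFn_eq_true_iff (g e m : List Bool) :
    powIsOneFn (boolPair g (boolPair e m)) = [true] ↔ 2 ≤ bitsToNat m ∧ bitsToNat g ^ bitsToNat e % bitsToNat m = 1 := by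
  simp only [powIsOneFn, Function.comp_apply, fanoutFn_apply, eqValFn_eq_true_iff]
  by_cases hm : 2 ≤ bitsToNat m
  · rw [modExpFn_boolPair hm]; simp [hm]
  · rw [modExpFn_boolPair_of_le (by omega)]; simp [hm]

/-- Context projections of the factor test `qTestFn` on `⟨⟨Ls, ⟨p, g⟩⟩, q⟩`. [folklore] -/
noncomputable def qLs : List Bool → List Bool := fstF ∘ fstF
/-- See `qLs`. [folklore] -/
noncomputable def qP : List Bool → List Bool := nthF 1 ∘ fstF
/-- See `qLs`. [folklore] -/
noncomputable def qG : List Bool → List Bool := sndPow 1 ∘ fstF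
/-- The exponent `(⟦p⟧ − 1) / ⟦q⟧` of the factor test. [folklore] -/
noncomputable def qExp : List Bool → List Bool := divFn ∘ fanoutFn (subFn ∘ fanoutFn qP (fun _ => [true])) sndF

/-- **The factor test** `qTestFn ⟨⟨Ls, ⟨p, g⟩⟩, q⟩`: `⟦q⟧` is certified by some line of `Ls`, and
`⟦g⟧^{(⟦p⟧−1)/⟦q⟧} mod ⟦p⟧ ≠ 1`. [cite: Pratt1975, pp. 214–220] -/
noncomputable def qTestFn : List Bool → List Bool :=
  andFn (memHeadFn ∘ fanoutFn sndF qLs) (notFn (powIsOneFn ∘ fanoutFn qG (fanoutFn qExp qP)))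

/-- `qTestFn ∈ FP`. [folklore] -/
theorem qTestFn_mem_FP : qTestFn ∈ FP := by
  have hLs : qLs ∈ FP := comp_mem_FP fstF_mem_FP fstF_mem_FP
  have hP : qP ∈ FP := comp_mem_FP (nthF_mem_FP 1) fstF_mem_FP
  have hG : qG ∈ FP := comp_mem_FP (sndPow_mem_FP 1) fstF_mem_FP
  have hE : qExp ∈ FP := comp_mem_FP divFn_mem_FP
    (fanoutFn_mem_FP (comp_mem_FP subFn_mem_FP (fanoutFn_mem_FP hP (const_mem_FP _))) sndF_mem_FP)
  exact andFn_mem_FP (comp_mem_FP memHeadFn_mem_FP (fanoutFn_mem_FP sndF_mem_FP hLs))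
    (notFn_mem_FP (comp_mem_FP powIsOneFn_mem_FP (fanoutFn_mem_FP hG (fanoutFn_mem_FP hE hP))))

/-- `qTestFn` is one-bit. [folklore] -/
theorem oneBit_qTestFn : OneBit qTestFn :=
  oneBit_andFn (oneBit_memHeadFn.comp _) (oneBit_notFn (oneBit_powIsOneFn.comp _))

/-- **Truth of the factor test.** [cite: Pratt1975, pp. 214–220] -/
theorem qTestFn_eq_true_iff (Ls p g q : List Bool) :
    qTestFn (boolPair (boolPair Ls (boolPair p g)) q) = [true] ↔
      bitsToNat q ∈ Pratt.heads (linesOf Ls) ∧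
        ¬ (2 ≤ bitsToNat p ∧ bitsToNat g ^ ((bitsToNat p - 1) / bitsToNat q) % bitsToNat p = 1) := by
  rw [qTestFn, andFn_eq_true_iff (oneBit_memHeadFn.comp _) (oneBit_notFn (oneBit_powIsOneFn.comp _)),
    notFn_eq_true_iff (oneBit_powIsOneFn.comp _)]
  simp only [Function.comp_apply, fanoutFn_apply, qLs, qP, qG, qExp, fstF_boolPair, sndF_boolPair,
    nthF_succ_boolPair, nthF_zero, sndPow_succ_boolPair, sndPow_zero, subFn_boolPair, divFn_boolPair,
    memHeadFn_eq_true_iff, powIsOneFn_eq_true_iff, bitsToNat_encodeNat, mem_heads_linesOf_iff]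
  simp

/-- Context projections of the line test `lineTestFn` on `⟨Ls, ⟨p, ⟨g, qs⟩⟩⟩`. [folklore] -/
noncomputable def lP : List Bool → List Bool := fstF ∘ sndF
/-- See `lP`. [folklore] -/
noncomputable def lG : List Bool → List Bool := nthF 1 ∘ sndF
/-- See `lP`. [folklore] -/
noncomputable def lQS : List Bool → List Bool := sndPow 1 ∘ sndF
/-- `⟦p⟧ − 1` for the line test. [folklore] -/
noncomputable def lPm1 : List Bool → List Bool := subFn ∘ fanoutFn lP (fun _ => [true])

/-- **The line test** `lineTestFn ⟨Ls, it⟩` of `it = ⟨p, ⟨g, qs⟩⟩` against the certificate `Ls`: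
`2 ≤ ⟦p⟧`, `⟦g⟧^{⟦p⟧−1} mod ⟦p⟧ = 1`, `∏ qs = ⟦p⟧ − 1`, and the factor test for every item of `qs`.
[cite: Pratt1975, pp. 214–220] -/
noncomputable def lineTestFn : List Bool → List Bool :=
  andFn (valGeTwoFn ∘ lP)
    (andFn (powIsOneFn ∘ fanoutFn lG (fanoutFn lPm1 lP))
      (andFn (eqValFn ∘ fanoutFn (prodListFn ∘ sndF ∘ sndF) lPm1)
        (allFn qTestFn ∘ fanoutFn (fanoutFn fstF (fanoutFn lP lG)) lQS)))

/-- `lineTestFn ∈ FP`. [cite: AroraBarakCC2009, §1.3] -/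
theorem lineTestFn_mem_FP : lineTestFn ∈ FP := by
  have hP : lP ∈ FP := comp_mem_FP fstF_mem_FP sndF_mem_FP
  have hG : lG ∈ FP := comp_mem_FP (nthF_mem_FP 1) sndF_mem_FP
  have hQS : lQS ∈ FP := comp_mem_FP (sndPow_mem_FP 1) sndF_mem_FP
  have hPm1 : lPm1 ∈ FP := comp_mem_FP subFn_mem_FP (fanoutFn_mem_FP hP (const_mem_FP _))
  exact andFn_mem_FP (comp_mem_FP valGeTwoFn_mem_FP hP)
    (andFn_mem_FP (comp_mem_FP powIsOneFn_mem_FP (fanoutFn_mem_FP hG (fanoutFn_mem_FP hPm1 hP)))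
      (andFn_mem_FP (comp_mem_FP eqValFn_mem_FP (fanoutFn_mem_FP (comp_mem_FP prodListFn_mem_FP (comp_mem_FP sndF_mem_FP sndF_mem_FP)) hPm1))
        (comp_mem_FP (allFn_mem_FP qTestFn_mem_FP oneBit_qTestFn) (fanoutFn_mem_FP (fanoutFn_mem_FP fstF_mem_FP (fanoutFn_mem_FP hP hG)) hQS))))

/-- `lineTestFn` is one-bit. [folklore] -/
theorem oneBit_lineTestFn : OneBit lineTestFn :=
  oneBit_andFn (oneBit_valGeTwoFn.comp _) (oneBit_andFn (oneBit_powIsOneFn.comp _)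
    (oneBit_andFn (oneBit_eqValFn.comp _) ((oneBit_allFn oneBit_qTestFn).comp _)))

/-- **Truth of the line test**: validity of the denoted line with respect to the heads of the
denoted certificate. [cite: Pratt1975, pp. 214–220] -/
theorem lineTestFn_eq_true_iff (Ls it : List Bool) :
    lineTestFn (boolPair Ls it) = [true] ↔ Pratt.LineValid (Pratt.heads (linesOf Ls)) (lineOf it) := by
  rw [lineTestFn, andFn_eq_true_iff (oneBit_valGeTwoFn.comp _) (oneBit_andFn (oneBit_powIsOneFn.comp _)
      (oneBit_andFn (oneBit_eqValFn.comp _) ((oneBit_allFn oneBit_qTestFn).comp _))),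
    andFn_eq_true_iff (oneBit_powIsOneFn.comp _) (oneBit_andFn (oneBit_eqValFn.comp _) ((oneBit_allFn oneBit_qTestFn).comp _)),
    andFn_eq_true_iff (oneBit_eqValFn.comp _) ((oneBit_allFn oneBit_qTestFn).comp _)]
  simp only [Function.comp_apply, fanoutFn_apply, lP, lG, lQS, lPm1, fstF_boolPair, sndF_boolPair,
    subFn_boolPair, bitsToNat_encodeNat, valGeTwoFn_eq_true_iff, powIsOneFn_eq_true_iff, eqValFn_eq_true_iff,
    allFn_eq_true_iff oneBit_qTestFn, qTestFn_eq_true_iff, prodListFn_apply]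
  simp only [Pratt.LineValid, lineOf, List.forall_mem_map, ne_eq]
  constructor
  · rintro ⟨h2, ⟨-, hpow⟩, hprod, hall⟩
    exact ⟨h2, hpow, hprod, fun a ha => ⟨(hall a ha).1, fun h => (hall a ha).2 ⟨h2, h⟩⟩⟩
  · rintro ⟨h2, hpow, hprod, hall⟩
    exact ⟨h2, ⟨h2, hpow⟩, hprod, fun a ha => ⟨(hall a ha).1, fun h => (hall a ha).2 h.2⟩⟩

/-- **The certificate test** `certTestFn Ls`: every item of `Ls` passes the line test against `Ls`.
[cite: Pratt1975, pp. 214–220] -/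
noncomputable def certTestFn : List Bool → List Bool := allFn lineTestFn ∘ fanoutFn id id

/-- `certTestFn ∈ FP`. [cite: AroraBarakCC2009, §1.3] -/
theorem certTestFn_mem_FP : certTestFn ∈ FP :=
  comp_mem_FP (allFn_mem_FP lineTestFn_mem_FP oneBit_lineTestFn)
    (fanoutFn_mem_FP (PolyTimeComputable.id _) (PolyTimeComputable.id _))

/-- `certTestFn` is one-bit. [folklore] -/
theorem oneBit_certTestFn : OneBit certTestFn := (oneBit_allFn oneBit_lineTestFn).comp _

/-- **Truth of the certificate test**: the denoted certificate is valid. [cite: Pratt1975, pp. 214–220] -/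
theorem certTestFn_eq_true_iff (Ls : List Bool) : certTestFn Ls = [true] ↔ Pratt.CertValid (linesOf Ls) := by
  rw [certTestFn, Function.comp_apply, fanoutFn_apply, id, allFn_eq_true_iff oneBit_lineTestFn]
  simp only [lineTestFn_eq_true_iff, Pratt.CertValid, linesOf, List.forall_mem_map]

/-- **Soundness of the verifier**: if the certificate test passes, every certified value is prime.
[cite: Pratt1975, pp. 214–220] -/
theorem prime_of_certTestFn {Ls : List Bool} (h : certTestFn Ls = [true]) {v : ℕ}
    (hv : v ∈ Pratt.heads (linesOf Ls)) : v.Prime :=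
  ((certTestFn_eq_true_iff Ls).1 h).prime_of_mem_heads hv

/-- **Completeness of the verifier**: the code of the certificate of a prime passes, and certifies
the prime. [cite: Pratt1975, pp. 214–220] -/
theorem certTestFn_encLines_lines {p : ℕ} (hp : p.Prime) :
    certTestFn (encLines (Pratt.lines p)) = [true] ∧ p ∈ Pratt.heads (linesOf (encLines (Pratt.lines p))) := by
  refine ⟨(certTestFn_eq_true_iff _).2 ?_, ?_⟩
  · rw [linesOf_encLines]; exact Pratt.certValid_lines hp
  · rw [linesOf_encLines]; exact Pratt.mem_heads_lines hp.pos

/-- Completeness for a factorisation: the code of the union of the certificates of a list of primes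
passes and certifies each of them. [cite: Pratt1975, pp. 214–220] -/
theorem certTestFn_encLines_flatMap {ps : List ℕ} (hps : ∀ p ∈ ps, p.Prime) :
    certTestFn (encLines (ps.flatMap Pratt.lines)) = [true] ∧
      ∀ p ∈ ps, p ∈ Pratt.heads (linesOf (encLines (ps.flatMap Pratt.lines))) := by
  refine ⟨(certTestFn_eq_true_iff _).2 ?_, fun p hp => ?_⟩
  · rw [linesOf_encLines]; exact Pratt.certValid_flatMap_lines hps
  · rw [linesOf_encLines]
    exact Pratt.heads_mono (fun l hl => List.mem_flatMap.2 ⟨p, hp, hl⟩) (Pratt.mem_heads_lines (hps p hp).pos)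

end PrattMachine

end Literature.Computability.QuantumComplexity
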